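import Mathlib
import Summits.Ventures.PercRepro2.SwOutCrossGenBitDefs

/-!
# The generic cross-arm cube with ONE extra dropped vertex, II: the non-core states and the
theorem (blind cell PercRepro2, night-4 g24, 2026-08-28; proofs/NIGHT4-G24.md §9)

The T-slab points with the single vertex dropped with blue outside edges inject into the B-slab
points with the vertex attached with red outside edges through `theta` (`card_x_leB`), and the
two core steps of `SwOutCrossGenBitDefs` handle the core states of the vertex:
**`card_le_crossGenBit`**.
-/

namespace Summit.Ventures.PercRepro2

namespace CrossArm

section Thm

variable {W A L : Type*} {ι : Type*} (F : FibreDataBit W A L)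
variable [Fintype ι] [DecidableEq ι] [Fintype W] [DecidableEq W]

open scoped Classical

variable [Nonempty ι]

omit [DecidableEq W] [Nonempty ι] in
/-- A non-leaking point whose single vertex is dropped with blue outside edges lies on the
T-slab. -/
lemma sTop_of_xB {𝒯 : Set (TypBG L ι)} {x : PtBG W ι} (hx : x ∈ QBG F 𝒯) (hb : x.2.2 = (false, true)) :
    x.1 = sTopG := by
  funext j
  by_contra hj
  have hj' : x.1 j = false := by
    cases h : x.1 j with
    | false => rfl
    | true => exact absurd h hj
  exact ((mem_QBG F).1 hx).1 (Or.inr (Or.inr ⟨⟨j, hj'⟩, by rw [hb], by rw [hb]⟩))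

omit [DecidableEq W] [Nonempty ι] in
/-- A non-leaking point whose single vertex is attached with red outside edges lies on the
B-slab. -/
lemma sBot_of_yB {𝒯 : Set (TypBG L ι)} {x : PtBG W ι} (hx : x ∈ QBG F 𝒯) (hb : x.2.2 = (true, false)) :
    x.1 = sBotG := by
  funext j
  by_contra hj
  have hj' : x.1 j = true := by
    cases h : x.1 j with
    | true => rfl
    | false => exact absurd h hj
  exact ((mem_QBG F).1 hx).1 (Or.inr (Or.inl ⟨⟨j, hj'⟩, by rw [hb], by rw [hb]⟩))

omit [Fintype ι] [DecidableEq ι] [Fintype W] [DecidableEq W] [Nonempty ι] in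
/-- On the B-slab the red atoms are empty. -/
lemma ERBG_sBot (w : W) (b : Bool × Bool) : ERBG F ((sBotG : Config ι), w, b) = ∅ := by
  simp only [ERBG]
  have h1 : ERG F.toFibreData ((sBotG : Config ι), w) = ∅ := ERG_sBot w
  rw [h1, Set.image_empty, Set.empty_union]
  ext a
  simp only [Set.mem_setOf_eq, Set.mem_empty_iff_false, iff_false, not_and]
  intro _ _ h
  exact not_redUG_bot h

omit [Fintype ι] [DecidableEq ι] [Fintype W] [DecidableEq W] [Nonempty ι] in
/-- The red atoms at the T-slab with the vertex dropped are the lifted atoms of the component. -/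
lemma ERBG_sTop_x (w : W) : ERBG F ((sTopG : Config ι), w, (false, true)) =
    liftAtom '' ERG F.toFibreData ((sTopG : Config ι), w) := by
  simp only [ERBG]
  rw [Set.union_eq_left]
  rintro a ⟨-, h, -⟩
  exact Bool.noConfusion h

omit [DecidableEq W] in
/-- **Step 3, the single vertex's non-core states**: the T-slab points with the vertex dropped
with blue outside edges inject into the B-slab points with the vertex attached with red outside
edges, through `theta`. -/
lemma card_x_leB {𝒯 : Set (TypBG L ι)} (h𝒯 : IsUpBG F 𝒯) {𝓔 : Set (Set (AtomBG A ι))}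
    (h𝓔 : IsUpperSet 𝓔) (hE : (∅ : Set (AtomBG A ι)) ∉ 𝓔) :
    ((QBG F 𝒯).filter fun x => x.2.2.1 ≠ x.2.2.2 ∧ ERBG F x ∈ 𝓔).card ≤
      ((QBG F 𝒯).filter fun x => x.2.2.1 ≠ x.2.2.2 ∧ EBBG F x ∈ 𝓔).card := by
  -- every point of the left side is a T-slab point with the vertex dropped-blue
  have hform : ∀ x ∈ (QBG F 𝒯).filter fun x => x.2.2.1 ≠ x.2.2.2 ∧ ERBG F x ∈ 𝓔,
      x.1 = sTopG ∧ x.2.2 = (false, true) ∧ F.leakR x.2.1 = false := by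
    intro x hx
    rw [Finset.mem_filter] at hx
    obtain ⟨hx, hne, hE'⟩ := hx
    have hb : x.2.2 = (false, true) := by
      cases ha : x.2.2.1 <;> cases he : x.2.2.2
      · exact absurd (by rw [ha, he]) hne
      · exact Prod.ext ha he
      · exfalso
        have hs := sBot_of_yB F hx (Prod.ext ha he)
        have : ERBG F x = ∅ := by
          rw [show x = (x.1, x.2.1, x.2.2) from rfl, hs]
          exact ERBG_sBot F _ _
        rw [this] at hE'
        exact hE hE'
      · exact absurd (by rw [ha, he]) hne
    have hs := sTop_of_xB F hx hb
    refine ⟨hs, hb, ?_⟩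
    have hl := ((mem_QBG F).1 hx).1
    cases h : F.leakR x.2.1 with
    | false => rfl
    | true =>
      exfalso
      exact hl (Or.inl (Or.inl ⟨by rw [hs]; exact redUG_top, h⟩))
  refine Finset.card_le_card_of_injOn (fun x => ((sBotG : Config ι), F.theta x.2.1, (true, false)))
    ?_ ?_
  · intro x hx
    rw [Finset.mem_coe] at hx ⊢
    obtain ⟨hs, hb, hl⟩ := hform x hx
    have hx' := hx
    rw [Finset.mem_filter] at hx' ⊢
    obtain ⟨hxQ, -, hE'⟩ := hx'
    obtain ⟨hθl, hθlab, hθred⟩ := F.theta_ok x.2.1 hl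
    refine ⟨?_, show (true : Bool) ≠ false from Bool.noConfusion, ?_⟩
    · rw [mem_QBG]
      refine ⟨?_, ?_⟩
      · rintro (h | ⟨⟨j, hj⟩, -⟩ | ⟨-, h1, -⟩)
        · rcases h with ⟨⟨j, hj⟩, -⟩ | ⟨-, h2⟩
          · exact Bool.noConfusion hj
          · rw [hθl] at h2; exact Bool.noConfusion h2
        · exact Bool.noConfusion hj
        · exact Bool.noConfusion h1
      · have ht := ((mem_QBG F).1 hxQ).2
        have ht' : (x.1, F.label x.2.1, true) ∈ 𝒯 := by
          have : typBG F x = (x.1, F.label x.2.1, true) := by simp [typBG, hb]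
          rw [← this]; exact ht
        show ((sBotG : Config ι), F.label (F.theta x.2.1), false) ∈ 𝒯
        exact h𝒯 _ ht' _ ⟨fun j _ => rfl, hθlab, fun _ => rfl⟩
    · -- the blue atoms of the image contain the red atoms of the source
      have hEB : EBBG F ((sBotG : Config ι), F.theta x.2.1, (true, false)) =
          liftAtom '' ERG F.toFibreData ((sTopG : Config ι), F.flip (F.theta x.2.1)) := by
        simp only [EBBG, flipBG, flipAll_sBotG, Bool.not_true, Bool.not_false]
        exact ERBG_sTop_x F _
      rw [hEB]
      have hER : ERBG F x = liftAtom '' ERG F.toFibreData ((sTopG : Config ι), x.2.1) := by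
        rw [show x = (x.1, x.2.1, x.2.2) from rfl, hs, hb]
        exact ERBG_sTop_x F _
      rw [hER] at hE'
      refine h𝓔 (Set.image_mono ?_) hE'
      rintro (j | (u | a)) ha
      · exact ha
      · exact ha
      · exact ⟨ha.1, hθred a ha.2⟩
  · intro x hx y hy hxy
    rw [Finset.mem_coe] at hx hy
    obtain ⟨hsx, hbx, hlx⟩ := hform x hx
    obtain ⟨hsy, hby, hly⟩ := hform y hy
    simp only [Prod.mk.injEq, true_and, and_true] at hxy
    have hw := F.theta_inj _ _ hlx hly hxy
    rw [show x = (x.1, x.2.1, x.2.2) from rfl, show y = (y.1, y.2.1, y.2.2) from rfl, hsx, hsy, hbx,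
      hby, hw]

/-- **THE ABSTRACT THEOREM OF BOUNDARY (iv) FOR A COMPONENT WITH ONE EXTRA DROPPED VERTEX**: on
every up-set of types, the red count is at most the blue count for every up-set of atom sets. -/
theorem card_le_crossGenBit {𝒯 : Set (TypBG L ι)} (h𝒯 : IsUpBG F 𝒯) {𝓔 : Set (Set (AtomBG A ι))}
    (h𝓔 : IsUpperSet 𝓔) :
    ((QBG F 𝒯).filter fun x => ERBG F x ∈ 𝓔).card ≤ ((QBG F 𝒯).filter fun x => EBBG F x ∈ 𝓔).card := by
  by_cases hE : (∅ : Set (AtomBG A ι)) ∈ 𝓔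
  · have hall : ∀ S : Set (AtomBG A ι), S ∈ 𝓔 := fun S => h𝓔 (Set.empty_subset S) hE
    rw [Finset.filter_true_of_mem fun _ _ => hall _, Finset.filter_true_of_mem fun _ _ => hall _]
  -- split both sides along the single vertex's core states
  have hR := Finset.card_filter_add_card_filter_not (s := (QBG F 𝒯).filter fun x => ERBG F x ∈ 𝓔)
    (fun x => x.2.2.1 = x.2.2.2)
  have hB := Finset.card_filter_add_card_filter_not (s := (QBG F 𝒯).filter fun x => EBBG F x ∈ 𝓔)
    (fun x => x.2.2.1 = x.2.2.2)
  simp only [Finset.filter_filter] at hR hB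
  -- the non-core states
  have hx := card_x_leB F h𝒯 h𝓔 hE
  have ex1 : ((QBG F 𝒯).filter fun x => ERBG F x ∈ 𝓔 ∧ ¬ x.2.2.1 = x.2.2.2) =
      (QBG F 𝒯).filter fun x => x.2.2.1 ≠ x.2.2.2 ∧ ERBG F x ∈ 𝓔 :=
    Finset.filter_congr fun _ _ => and_comm
  have ex2 : ((QBG F 𝒯).filter fun x => EBBG F x ∈ 𝓔 ∧ ¬ x.2.2.1 = x.2.2.2) =
      (QBG F 𝒯).filter fun x => x.2.2.1 ≠ x.2.2.2 ∧ EBBG F x ∈ 𝓔 :=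
    Finset.filter_congr fun _ _ => and_comm
  rw [ex1] at hR
  rw [ex2] at hB
  -- the core states: fibre by the bit
  have c1 : ((QBG F 𝒯).filter fun x => ERBG F x ∈ 𝓔 ∧ x.2.2.1 = x.2.2.2).card =
      ∑ b : Bool, ((QBG F 𝒯).filter fun x => x.2.2 = (b, b) ∧ ERBG F x ∈ 𝓔).card := by
    rw [Finset.card_eq_sum_card_fiberwise (f := fun x => x.2.2.1) (t := Finset.univ)
      (fun _ _ => Finset.mem_univ _)]
    refine Finset.sum_congr rfl fun b _ => ?_
    rw [Finset.filter_filter]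
    congr 1
    apply Finset.filter_congr
    intro x _
    constructor
    · rintro ⟨⟨hE', hc⟩, hb⟩
      exact ⟨Prod.ext hb (hc.symm.trans hb), hE'⟩
    · rintro ⟨hb, hE'⟩
      exact ⟨⟨hE', by rw [hb]⟩, by rw [hb]⟩
  have c2 : ((QBG F 𝒯).filter fun x => x.2.2.1 = x.2.2.2 ∧ EBpre F x.2.2.1 x ∈ 𝓔).card =
      ∑ b : Bool, ((QBG F 𝒯).filter fun x => x.2.2 = (b, b) ∧ EBpre F b x ∈ 𝓔).card := by
    rw [Finset.card_eq_sum_card_fiberwise (f := fun x => x.2.2.1) (t := Finset.univ)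
      (fun _ _ => Finset.mem_univ _)]
    refine Finset.sum_congr rfl fun b _ => ?_
    rw [Finset.filter_filter]
    congr 1
    apply Finset.filter_congr
    intro x _
    constructor
    · rintro ⟨⟨hc, hE'⟩, hb⟩
      refine ⟨Prod.ext hb (hc.symm.trans hb), ?_⟩
      rw [← hb]; exact hE'
    · rintro ⟨hb, hE'⟩
      refine ⟨⟨by rw [hb], ?_⟩, by rw [hb]⟩
      have : x.2.2.1 = b := by rw [hb]
      rw [this]; exact hE'
  have c3 : ((QBG F 𝒯).filter fun x => x.2.2.1 = x.2.2.2 ∧ EBpre F x.2.2.1 x ∈ 𝓔).card =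
      ∑ q : PtG W ι, ((QBG F 𝒯).filter fun x =>
        (x.1, x.2.1) = q ∧ x.2.2.1 = x.2.2.2 ∧ EBpre F x.2.2.1 x ∈ 𝓔).card := by
    rw [Finset.card_eq_sum_card_fiberwise (f := fun x => (x.1, x.2.1)) (t := Finset.univ)
      (fun _ _ => Finset.mem_univ _)]
    refine Finset.sum_congr rfl fun q _ => ?_
    rw [Finset.filter_filter]
    congr 1
    apply Finset.filter_congr
    intro x _
    exact and_comm
  have c4 : ((QBG F 𝒯).filter fun x => EBBG F x ∈ 𝓔 ∧ x.2.2.1 = x.2.2.2).card =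
      ∑ q : PtG W ι, ((QBG F 𝒯).filter fun x =>
        (x.1, x.2.1) = q ∧ x.2.2.1 = x.2.2.2 ∧ EBBG F x ∈ 𝓔).card := by
    rw [Finset.card_eq_sum_card_fiberwise (f := fun x => (x.1, x.2.1)) (t := Finset.univ)
      (fun _ _ => Finset.mem_univ _)]
    refine Finset.sum_congr rfl fun q _ => ?_
    rw [Finset.filter_filter]
    congr 1
    apply Finset.filter_congr
    intro x _
    constructor
    · rintro ⟨⟨hE', hc⟩, hq⟩
      exact ⟨hq, hc, hE'⟩
    · rintro ⟨hq, hc, hE'⟩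
      exact ⟨⟨hE', hc⟩, hq⟩
  have hcore : ((QBG F 𝒯).filter fun x => ERBG F x ∈ 𝓔 ∧ x.2.2.1 = x.2.2.2).card ≤
      ((QBG F 𝒯).filter fun x => EBBG F x ∈ 𝓔 ∧ x.2.2.1 = x.2.2.2).card :=
    calc ((QBG F 𝒯).filter fun x => ERBG F x ∈ 𝓔 ∧ x.2.2.1 = x.2.2.2).card
        = ∑ b : Bool, ((QBG F 𝒯).filter fun x => x.2.2 = (b, b) ∧ ERBG F x ∈ 𝓔).card := c1
      _ ≤ ∑ b : Bool, ((QBG F 𝒯).filter fun x => x.2.2 = (b, b) ∧ EBpre F b x ∈ 𝓔).card :=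
          Finset.sum_le_sum fun b _ => card_frozen_leB F h𝒯 h𝓔 b
      _ = ((QBG F 𝒯).filter fun x => x.2.2.1 = x.2.2.2 ∧ EBpre F x.2.2.1 x ∈ 𝓔).card := c2.symm
      _ = ∑ q : PtG W ι, ((QBG F 𝒯).filter fun x =>
            (x.1, x.2.1) = q ∧ x.2.2.1 = x.2.2.2 ∧ EBpre F x.2.2.1 x ∈ 𝓔).card := c3
      _ ≤ ∑ q : PtG W ι, ((QBG F 𝒯).filter fun x =>
            (x.1, x.2.1) = q ∧ x.2.2.1 = x.2.2.2 ∧ EBBG F x ∈ 𝓔).card :=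
          Finset.sum_le_sum fun q _ => card_bitB_le F h𝒯 h𝓔 q
      _ = ((QBG F 𝒯).filter fun x => EBBG F x ∈ 𝓔 ∧ x.2.2.1 = x.2.2.2).card := c4.symm
  omega

end Thm

end CrossArm

end Summit.Ventures.PercRepro2
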